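import Summits.Parity.GeneralizedHardyLittlewood.Theorems.RootExistenceConservationTwins


/-!
# Root existence conservation — the cycle-2 blocker certificate of the decomp-parity cell (lens-6 g9)
(4/4 — §5.5–§5.9: the barrier tie `root_certificate`, the count currency, doors 18 / 5 / 13 / 15 / 16 typed.  Landed
verbatim from the lens-6 g9 hand @471e26ada0e68a15 in four files by census-1 g10; parts 1–3 =
`RootExistenceConservationShapes` / `…Patterns` / `…Twins`, vocabulary `RootExistenceConservationDefs`; lens-6 g9 NODE
HOME/STATUS.md l.468 / v2 l.481, critic CLEARED l.472 = CRITIC-LEDGER row 87, writer LANDING LIST L5 l.476.)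

Theorems-grade re-target, to the ROOT `Parity := BatemanHorn ∧ GeneralizedHardyLittlewood`, of the lens-6 g8
kernel «ExistenceConservation» (critic CLEARED as CERTIFICATE, STANDING TRAP T22 «existence conservation /
poverty-vacuity test», HOME/STATUS.md l.440; writer ACK of the operator's CYCLE-2 ORDER, l.439: «the cycle-2
node = a LEAN-STATED BLOCKER CERTIFICATE at the root, built from lens-6 g8»).

**The world.** `TwinPoor := Σ_{n≤N} Λ(n)Λ(n+2) = o(N)` — the Λ-form of «the twin primes are (density-)finite».
It is refuted by the root (`parity_refutes_twinPoor`), by the conjunct `GeneralizedHardyLittlewood`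
(`ghl_refutes_twinPoor`) and by the record leaf `SiegelSpectrumSplit.FixedLower` (stmt-Parity-26863,
`fixedLower_refutes_twinPoor`); its negation is EQUIVALENT to the Chebyshev-order twin lower bound infinitely
often (`not_twinPoor_iff_chebyshevIO`, the Λ-currency of the hub blocker stmt-Parity-18377) and IMPLIES
`Literature.Barriers.Parity.twinSet.Infinite` (`twinSet_infinite_of_not_twinPoor`, via Chebyshev's
`ψ − θ ≪ √x log x` from Mathlib: prime powers are negligible).

**(i) Conservation schema at the root** (`root_conservation`, n-ary; `complement_refutes{,₂,₃}` curried): for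
every split `Parity ⟸ ⋀ᵢ Pᵢ` and every sub-family `V` of pieces each PROVABLY implied by `TwinPoor`
(«W-vacuous»: upper envelopes, dichotomies, synchronisations of poor families, two-scale rigidity, relative
statements `(lower bound) → T`, `Q`-conditioned vacuous pieces, pieces conditioned on a refuting piece), the
conjunction of the REMAINING pieces implies `¬TwinPoor`.  If every piece were W-vacuous, `¬TwinPoor` would be a
theorem (`all_vacuous_refutes`).
**(ii)** `¬TwinPoor ↔ ChebyshevIO (X 2)` and `¬TwinPoor → twinSet.Infinite`; the COUNT currency of the hub blocker
stmt-Parity-18377 (`∃ c > 0, π₂(x) ≥ c·x/log²x` eventually) implies `¬TwinPoor` (`countLower_refutes_twinPoor`: the twins in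
`(√N, N]` weigh `≥ log²N/4` each), and the conjunct `BatemanHorn` refutes `TwinPoor` through `π₂ ∼ 2C₂x/log²x`
(`batemanHorn_refutes_twinPoor`, the tree proof of `twinPrimeCount_isEquivalent_of_batemanHorn` at the twin instance):
BOTH root conjuncts are W-refuting (`record_root_locus`), and so is the BH-side record residual `LinearCell`
(stmt-Parity-25178; `linearCell_refutes_twinPoor`, `bh_record_locus`).
**(iii) Barrier tie BY NAME** (`root_certificate`): the W-refuting complement of every root split yields
`twinSet.Infinite`, while `Literature.Barriers.Parity.PrimePairParity_holds` says that no sieve-theoretic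
deduction whose inputs are met by the parity weight `1 − λ(n)λ(n+2)` detects `twinSet` at all — so that
complement needs a non-sieve-theoretic input (in the precise sense of `IsSieveTheoreticDeduction`).
**(iv) Ledger instances** (§3–§4, §5.4–§5.9; the 19 vetted root doors of TRIB-PARITY-ROOTDECOMP-1, wording per the
critic's P1, HOME/STATUS.md l.472).  Record `SiegelSpectrumSplit`: `Q` vacuous (mod the typed fact
`MatomakiMerikoski2023_fixedShift`), `UniformLowerGivenFixed` vacuous (its antecedent `FixedLower` is refuting), `FixedUpper`
vacuous in every per-pattern ghost world, `FixedLower` and `LowerGivenBoundedSiegel` refuting; BH record: `LinearCell`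
refuting.  Over the 19 doors: in 15/19 the W-refuting burden sits in the RESIDUAL RELATIVE TO the credited pieces
(credited = W-vacuous TYPED, or W-consistent at shape level) — typed outright in 8 (doors 1, 2, 3, 10, 14, 17, 19, and 18 by
`logWindowHL_refutes_twinPoor`), typed as «residual ∧ credited ⟹ ¬W» in doors 13 / 15 / 16
(`pairLift_and_twoOfThree_refute_twinPoor`, `artinLift_and_artinTwo_refute_twinPoor`,
`factorLift_and_shiftedLPF_refute_twinPoor`; `lift_residual_inside_twinPoor`: a lift residual ALONE is not W-refuting),
shape-level in doors 4, 9, 11, 12; in 2/19 (door 5, typed `pairsToGHL_of_twinPoor` / `barrierZone_locus`; door 7, typed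
`not_twinPoor_of_far_sync`) the residual is W-VACUOUS and the ATTACKED complement carries `¬TwinPoor`; 2/19 (doors 6, 8,
shift-rigidity residuals) are open at instance level with the dichotomy recorded.  Never «the residual alone implies
¬TwinPoor» for a dividing door.  Nothing here proves or refutes an open item.

Honest rider: the certificate is RELATIVE («every root split leaves a residual sub-conjunction implying
`¬TwinPoor`»); `¬TwinPoor` is strictly weaker than `FixedLower` (it is the twin prime conjecture in
Chebyshev-i.o. form); nothing in this file bears on the truth of `Parity`.

0 sorry · standard axioms.  Sources: GreenTao2010 (Conj. 1.2), Polymath8b2014 §8, Selberg1949, Bombieri1976,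
HardyLittlewood1923, MatomakiMerikoski2023; Mathlib `Chebyshev.abs_psi_sub_theta_le_sqrt_mul_log`.
-/
open scoped BigOperators
open Finset

namespace Summit.Parity.GeneralizedHardyLittlewood.ExistenceConservation

/-! ## §3 The twin face of route-Parity-ClusterGapCarving, BY NAME -/

open scoped ArithmeticFunction.vonMangoldt
open Literature.NumberTheory.Sieve

open ScaleTauberianCarving (err dil FixedAt ScaleRigidityAt convex_dil dil_subset_realBox)

variable {d t : ℕ}


section Root

open Literature.NumberTheory.Sieve
open Literature.Barriers.Parity (twinSet twinParityWeight IsSieveTheoreticDeduction PrimePairParity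
  PrimePairParity_holds)

/-! ### §5.5 (iii) The barrier tie, BY NAME: `Literature.Barriers.Parity.PrimePairParity_holds` -/

/-- No sieve-theoretic deduction whose inputs are met by the twin parity weight `1 − λ(n)λ(n+2)` detects `twinSet`
(Selberg / Bombieri / Polymath8b §8, typed). [cite: Polymath8b2014, §8 (8.8)–(8.9)] -/
theorem no_sieveTheoretic_twin_deduction (Inputs : (ℕ → ℝ) → Prop) (hIn : Inputs twinParityWeight) :
    ¬ IsSieveTheoreticDeduction Inputs twinSet :=
  (PrimePairParity_holds Inputs).1 hIn

/-- Contrast: an UNWEIGHTED sieve-theoretic deduction for `twinSet` produces a twin (Polymath8b §8). -/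
theorem sieveTheoretic_deduction_yields_twin {Inputs : (ℕ → ℝ) → Prop}
    (h : IsSieveTheoreticDeduction Inputs twinSet) (h1 : Inputs fun _ => 1) : ∃ n : ℕ, n ∈ twinSet := by
  obtain ⟨_, n, _, hn⟩ := h.exists_mem h1
  exact ⟨n, hn⟩

/-- **THE ROOT CERTIFICATE.** For every split of `Parity` into pieces `Pᵢ` and every sub-family `V` of
`TwinPoor`-vacuous pieces: (a) the remaining pieces jointly yield INFINITELY MANY TWIN PRIMES; (b) no
sieve-theoretic deduction with parity-weight-invariant inputs detects `twinSet` (`PrimePairParity_holds`).  Hence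
the W-refuting complement of every root split — through any family of routes — needs an input outside the class
`IsSieveTheoreticDeduction` for `twinSet`: the `d = 1, t = 2` existence statement sits inside the catalogued
barrier `Literature.Barriers.Parity.PrimePairParity`. -/
theorem root_certificate {ι : Sort*} (P V : ι → Prop) (hs : (∀ i, P i) → _root_.Parity)
    (hV : ∀ i, V i → TwinPoor → P i) :
    ((∀ i, ¬ V i → P i) → twinSet.Infinite) ∧
      ∀ Inputs : (ℕ → ℝ) → Prop, Inputs twinParityWeight → ¬ IsSieveTheoreticDeduction Inputs twinSet :=
  ⟨fun hR => twinSet_infinite_of_not_twinPoor (root_conservation P V hs hV hR),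
    no_sieveTheoretic_twin_deduction⟩

/-- Binary form used by the critic's trap T22: a root split `Parity ⟸ A ∧ R` with `TwinPoor → A` has
`R → twinSet.Infinite`. -/
theorem root_certificate₂ {A R : Prop} (hs : A → R → _root_.Parity) (hA : TwinPoor → A) :
    R → twinSet.Infinite :=
  fun r => twinSet_infinite_of_not_twinPoor (complement_refutes hA hs parity_refutes_twinPoor r)

/-! ### §5.6 The count currency (stmt-Parity-18377) and the BH conjunct refute `TwinPoor` -/

/-- **Count ⟹ Λ.** A Hardy–Littlewood-scale lower bound for the twin prime COUNT, `c·x/log²x ≤ π₂(x)` eventually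
(the shape of the hub blocker stmt-Parity-18377 `TwinLowerDensity`), gives the eventual Λ-Chebyshev twin lower bound:
the twins in `(√N, N]` each weigh `≥ log²N/4`, and there are `≥ π₂(N) − √N − 1` of them. -/
theorem chebyshevEv_of_countLower
    (h : ∃ c : ℝ, 0 < c ∧ ∃ x₀ : ℕ, ∀ x : ℕ, x₀ ≤ x →
      c * (x : ℝ) / Real.log (x : ℝ) ^ 2 ≤ (twinPrimeCount x : ℝ)) :
    ChebyshevEv (X 2) := by
  classical
  obtain ⟨c, hc, x₀, hx₀⟩ := h
  obtain ⟨N₁, hN₁⟩ := eventually_logSq_sqrt_le (C := (1 : ℝ)) zero_le_one (half_pos hc)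
  refine ⟨c / 8, by positivity, max (max x₀ N₁) 2, fun N hN => ?_⟩
  have hNx₀ : x₀ ≤ N := le_trans (le_max_left _ _) (le_of_max_le_left hN)
  have hNN₁ : N₁ ≤ N := le_trans (le_max_right _ _) (le_of_max_le_left hN)
  have hN2 : 2 ≤ N := le_of_max_le_right hN
  have hNr : (2 : ℝ) ≤ N := by exact_mod_cast hN2
  have hlogN : 0 < Real.log N := Real.log_pos (by linarith)
  set s := Nat.sqrt N with hs
  -- the twins in `(s, N]`
  set T := (Finset.Icc 1 N).filter (fun n => n.Prime ∧ (n + 2).Prime ∧ s < n) with hT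
  -- (1) each weighs at least log²N/4
  have hw : ∀ n ∈ T, Real.log N ^ 2 / 4 ≤ Λ n * Λ (n + 2) := by
    intro n hn
    rw [hT, Finset.mem_filter, Finset.mem_Icc] at hn
    obtain ⟨⟨hn1, hnN⟩, hp, hq, hsn⟩ := hn
    rw [ArithmeticFunction.vonMangoldt_apply_prime hp, ArithmeticFunction.vonMangoldt_apply_prime hq]
    have hsq : N < (s + 1) ^ 2 := by rw [hs]; exact Nat.lt_succ_sqrt' N
    have hn2 : N < n ^ 2 := lt_of_lt_of_le hsq (Nat.pow_le_pow_left (by omega) 2)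
    have hn2r : (N : ℝ) ≤ (n : ℝ) ^ 2 := by exact_mod_cast hn2.le
    have hn0 : (0 : ℝ) < n := by exact_mod_cast (by omega : 0 < n)
    have hlog : Real.log N ≤ 2 * Real.log n := by
      have h' : Real.log N ≤ Real.log ((n : ℝ) ^ 2) := Real.log_le_log (by linarith) hn2r
      rw [Real.log_pow] at h'
      simpa using h'
    have hlog2 : Real.log n ≤ Real.log ((n : ℝ) + 2) := Real.log_le_log hn0 (by linarith)
    have hln0 : 0 ≤ Real.log n := Real.log_nonneg (by exact_mod_cast hn1)
    push_cast
    nlinarith [mul_le_mul hlog hlog hlogN.le (by linarith), mul_le_mul_of_nonneg_left hlog2 hln0]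
  -- (2) their number
  have hcardT : (twinPrimeCount N : ℝ) - (s + 1) ≤ T.card := by
    have hsub : (Finset.range (N + 1)).filter (fun n => n.Prime ∧ (n + 2).Prime) \ Finset.range (s + 1) ⊆ T := by
      intro n hn
      rw [Finset.mem_sdiff, Finset.mem_filter, Finset.mem_range, Finset.mem_range] at hn
      rw [hT, Finset.mem_filter, Finset.mem_Icc]
      obtain ⟨⟨hnN, hp, hq⟩, hns⟩ := hn
      exact ⟨⟨by omega, by omega⟩, hp, hq, by omega⟩
    have h1 := Finset.card_le_card hsub
    have h2 := Finset.le_card_sdiff (Finset.range (s + 1))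
      ((Finset.range (N + 1)).filter (fun n => n.Prime ∧ (n + 2).Prime))
    rw [Finset.card_range] at h2
    have h3 : twinPrimeCount N = ((Finset.range (N + 1)).filter (fun n => n.Prime ∧ (n + 2).Prime)).card := rfl
    have h4 : twinPrimeCount N ≤ T.card + (s + 1) := by rw [h3]; omega
    have h5 : (twinPrimeCount N : ℝ) ≤ (T.card : ℝ) + ((s : ℝ) + 1) := by exact_mod_cast h4
    linarith
  -- (3) `s ≤ √N ≤ 4√(N+2)`, and the tail budget from `eventually_logSq_sqrt_le`
  have hsr : (s : ℝ) ≤ Real.sqrt ((N : ℝ) + 2) := by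
    refine Real.le_sqrt_of_sq_le ?_
    have : s ^ 2 ≤ N := by rw [hs]; exact Nat.sqrt_le' N
    have : ((s : ℝ)) ^ 2 ≤ N := by exact_mod_cast this
    linarith
  have hlogle : Real.log N ≤ Real.log ((N : ℝ) + 2) := Real.log_le_log (by linarith) (by linarith)
  have hbudget := hN₁ N hNN₁
  -- log²N·(s+1) ≤ log²(N+2)·(1 + 4√(N+2)) ≤ (c/2)·N
  have htail : Real.log N ^ 2 * ((s : ℝ) + 1) ≤ c / 2 * N := by
    have hs0 : (0 : ℝ) ≤ s := Nat.cast_nonneg s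
    have hl2 : Real.log N ^ 2 ≤ Real.log ((N : ℝ) + 2) ^ 2 := pow_le_pow_left₀ hlogN.le hlogle 2
    calc Real.log N ^ 2 * ((s : ℝ) + 1) ≤ Real.log ((N : ℝ) + 2) ^ 2 * (1 + 4 * Real.sqrt ((N : ℝ) + 2)) := by
          apply mul_le_mul hl2 (by linarith) (by positivity) (by positivity)
      _ ≤ c / 2 * N := hbudget
  -- (4) the count lower bound at `N`
  have hcount := hx₀ N hNx₀
  have hmain : c * N ≤ (twinPrimeCount N : ℝ) * Real.log N ^ 2 := by
    have := (div_le_iff₀ (by positivity : (0 : ℝ) < Real.log N ^ 2)).mp hcount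
    linarith
  -- (5) assemble
  have hsumT : (T.card : ℝ) * (Real.log N ^ 2 / 4) ≤ ∑ n ∈ T, Λ n * Λ (n + 2) := by
    have := Finset.card_nsmul_le_sum T (fun n => Λ n * Λ (n + 2)) _ hw
    rwa [nsmul_eq_mul] at this
  have hTX : ∑ n ∈ T, Λ n * Λ (n + 2) ≤ X 2 N :=
    Finset.sum_le_sum_of_subset_of_nonneg (Finset.filter_subset _ _) fun n _ _ =>
      mul_nonneg ArithmeticFunction.vonMangoldt_nonneg ArithmeticFunction.vonMangoldt_nonneg
  have hl0 : 0 ≤ Real.log N ^ 2 / 4 := by positivity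
  nlinarith [mul_le_mul_of_nonneg_right hcardT hl0, hsumT, hTX, hmain, htail]

/-- The hub blocker's COUNT currency refutes `TwinPoor` and yields `twinSet.Infinite`: every statement of the shape of
stmt-Parity-18377 (`∃ c > 0, π₂(x) ≥ c·x/log²x` eventually) is `W`-refuting. -/
theorem countLower_refutes_twinPoor
    (h : ∃ c : ℝ, 0 < c ∧ ∃ x₀ : ℕ, ∀ x : ℕ, x₀ ≤ x →
      c * (x : ℝ) / Real.log (x : ℝ) ^ 2 ≤ (twinPrimeCount x : ℝ)) : ¬ TwinPoor :=
  not_poor_of_chebyshevEv (chebyshevEv_of_countLower h)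

/-- The Bateman–Horn asymptotic for the twin system `(x, x+2)` ALONE gives `π₂(x) ∼ 2C₂·x/log²x` (the tree proof of
`twinPrimeCount_isEquivalent_of_batemanHorn` uses Bateman–Horn only at this instance; `C = 2C₂` by uniqueness of
limits and the tree fact `tendsto_twinPrimeConstPartial_holds`). -/
theorem twinCount_isEquivalent_of_twinAsymptotic (h : BatemanHornAsymptotic twinSystem) :
    Asymptotics.IsEquivalent Filter.atTop (fun x : ℕ => (twinPrimeCount x : ℝ))
      (fun x : ℕ => 2 * twinPrimeConst * x / Real.log x ^ 2) := by
  obtain ⟨C, hC, hQ⟩ := h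
  have hCeq : C = 2 * twinPrimeConst :=
    tendsto_nhds_unique hC (hasBatemanHornConst_twinSystem tendsto_twinPrimeConstPartial_holds)
  convert hQ using 2 with x x
  · rw [polyPrimeCount_twinSystem]
  · have hdeg : ((Polynomial.X : Polynomial ℤ) + 2).natDegree = 1 := by
      simpa using Polynomial.natDegree_X_add_C (2 : ℤ)
    simp [twinSystem, hCeq, hdeg]

/-- The twin instance of Bateman–Horn refutes `TwinPoor` (count lower bound with `c = C₂`, then `countLower_refutes_twinPoor`). -/
theorem twinAsymptotic_refutes_twinPoor (h : BatemanHornAsymptotic twinSystem) : ¬ TwinPoor := by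
  apply countLower_refutes_twinPoor
  have hC : 0 < twinPrimeConst := twinPrimeConst_pos_holds
  have heq := twinCount_isEquivalent_of_twinAsymptotic h
  have hlo := heq.isLittleO.def (by norm_num : (0 : ℝ) < 1 / 2)
  obtain ⟨x₀, hx₀⟩ := Filter.eventually_atTop.mp hlo
  refine ⟨twinPrimeConst, hC, max x₀ 2, fun x hx => ?_⟩
  have hxx₀ : x₀ ≤ x := le_of_max_le_left hx
  have hx2 : (2 : ℝ) ≤ x := by exact_mod_cast le_of_max_le_right hx
  have key := hx₀ x hxx₀
  simp only [Pi.sub_apply, Real.norm_eq_abs] at key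
  have hv0 : 0 ≤ 2 * twinPrimeConst * (x : ℝ) / Real.log (x : ℝ) ^ 2 := by positivity
  rw [abs_of_nonneg hv0] at key
  have := (abs_le.mp key).1
  have e : twinPrimeConst * (x : ℝ) / Real.log (x : ℝ) ^ 2 =
      (1 / 2) * (2 * twinPrimeConst * (x : ℝ) / Real.log (x : ℝ) ^ 2) := by ring
  rw [e]
  linarith

/-- **The BH conjunct refutes twin poverty**: `BatemanHorn` contains the twin instance.  So at the root split
`Parity ⟸ BatemanHorn ∧ GeneralizedHardyLittlewood` BOTH conjuncts are `W`-refuting. -/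
theorem batemanHorn_refutes_twinPoor (hBH : _root_.BatemanHorn) : ¬ TwinPoor :=
  twinAsymptotic_refutes_twinPoor (hBH 2 twinSystem isBatemanHornSystem_twinSystem)

/-- The BH-side record residual `LinearCell` (stmt-Parity-25178, the imported complement of
route-Parity-OneSidedDegreeLadder / OddParityLadder: Bateman–Horn for all-linear systems) contains the twin
instance too, hence is `W`-REFUTING: the BH record split `BH ⟸ LinearCell ∧ UpperNonlinear ∧ LowerNonlinear`
keeps the twin existence content in its imported residual. -/
theorem linearCell_refutes_twinPoor (hL : Summit.Parity.BatemanHorn.Theses.OneSidedDegreeLadder.LinearCell) :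
    ¬ TwinPoor := by
  refine twinAsymptotic_refutes_twinPoor (hL 2 twinSystem isBatemanHornSystem_twinSystem ?_)
  have hdeg : ((Polynomial.X : Polynomial ℤ) + 2).natDegree = 1 := by
    simpa using Polynomial.natDegree_X_add_C (2 : ℤ)
  intro i
  fin_cases i
  · simp [twinSystem]
  · simpa [twinSystem] using hdeg

/-- Root split of the record: `Parity ⟸ BatemanHorn ∧ (Q ∧ FU ∧ UU ∧ FL ∧ UL)`; its `W`-refuting pieces are
`BatemanHorn` and `FixedLower` (each alone refutes `W`), `UL` is `W`-vacuous and `Q` is `W`-vacuous mod MM. -/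
theorem record_root_locus :
    (_root_.BatemanHorn → ¬ TwinPoor) ∧ (Theses.SiegelSpectrumSplit.FixedLower → ¬ TwinPoor) ∧
      (TwinPoor → Theses.SiegelSpectrumSplit.UniformLowerGivenFixed) ∧
        (Literature.Barriers.Parity.MatomakiMerikoski2023_fixedShift →
          TwinPoor → Theses.SiegelSpectrumSplit.BoundedSiegelZeroQuality) :=
  ⟨batemanHorn_refutes_twinPoor, fixedLower_refutes_twinPoor, uniformLowerGivenFixed_of_twinPoor,
    boundedSiegel_of_twinPoor⟩

/-- BH-side record split `BatemanHorn ⟸ LinearCell ∧ UpperNonlinear ∧ LowerNonlinear` (route-Parity-OneSidedDegreeLadder):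
the imported residual `LinearCell` alone refutes `W`; by conservation nothing forces the nonlinear pieces to. -/
theorem bh_record_locus :
    (Summit.Parity.BatemanHorn.Theses.OneSidedDegreeLadder.LinearCell → ¬ TwinPoor) ∧ (_root_.BatemanHorn → ¬ TwinPoor) :=
  ⟨linearCell_refutes_twinPoor, batemanHorn_refutes_twinPoor⟩

/-! ### §5.7 Door 18 typed: the residual `LogWindowHL` (stmt-Parity-31399) refutes `TwinPoor` -/

/-- The dilate of the box `[-N,N]` to scale `n ≥ 1` is the box `[-n,n]` (`N ≠ 0`). -/
theorem dil_realBox_one {N n : ℕ} (hN : N ≠ 0) (hn : n ≠ 0) :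
    dil N n (realBox 1 (N : ℝ)) = realBox 1 (n : ℝ) := by
  have hNpos : (0 : ℝ) < N := by exact_mod_cast Nat.pos_of_ne_zero hN
  have hnpos : (0 : ℝ) < n := by exact_mod_cast Nat.pos_of_ne_zero hn
  apply subset_antisymm (dil_subset_realBox hN subset_rfl)
  intro x hx
  simp only [realBox, Set.mem_Icc] at hx
  obtain ⟨h1, h2⟩ := hx
  refine ⟨fun i => (N : ℝ) / n * x i, ?_, ?_⟩
  · simp only [realBox, Set.mem_Icc]
    have hc : (0 : ℝ) ≤ (N : ℝ) / n := by positivity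
    have hcn : (N : ℝ) / n * n = N := by field_simp
    refine ⟨fun i => ?_, fun i => ?_⟩
    · have hi := mul_le_mul_of_nonneg_left (h1 i) hc
      have : (N : ℝ) / n * (-(n : ℝ)) = -N := by rw [mul_neg, hcn]
      simp only []
      linarith
    · have hi := mul_le_mul_of_nonneg_left (h2 i) hc
      simp only []
      linarith
  · funext i
    simp only [Pi.smul_apply, smul_eq_mul]
    field_simp

/-- `LogWindowHL` at the twin system IS the shape `LogExact (X 2) 𝔖_twin`: by the twin dictionary
(`vonMangoldtSum_twinPrimeSystem`, `archFactor_twinPrimeSystem`) the normalised signed error at scale `n` on the dilated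
box is `X 2 n / n − 𝔖_twin`. -/
theorem logExact_twin_of_logWindowHL (h : Theses.ScaleTauberianCarving.LogWindowHL) :
    LogExact (X 2) (singularProduct twinPrimeSystem) := by
  intro ε hε
  have hA := (ScaleTauberianCarving.logWindowHL_iff.mp h) 1 2 le_rfl (by norm_num) twinPrimeSystem
    isNondegenerateSystem_twinPrimeSystem.1
  obtain ⟨N₀, hN₀⟩ := hA ε hε
  refine ⟨max N₀ 1, fun N hN M hM => ?_⟩
  have hNN₀ : N₀ ≤ N := le_of_max_le_left hN
  have hN1 : 1 ≤ N := le_of_max_le_right hN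
  have key := hN₀ N hNN₀ M hM (realBox 1 N) (convex_Icc _ _) subset_rfl
  have hterm : ∀ n ∈ Finset.Ioc N M,
      err twinPrimeSystem (dil N n (realBox 1 (N : ℝ))) n / (n : ℝ) ^ 1 / n =
        (X 2 n / n - singularProduct twinPrimeSystem) / n := by
    intro n hn
    have hn1 : N < n := (Finset.mem_Ioc.mp hn).1
    have hn0 : (n : ℝ) ≠ 0 := by
      have : 0 < n := by omega
      positivity
    rw [dil_realBox_one (by omega) (by omega)]
    unfold err
    rw [vonMangoldtSum_twinPrimeSystem, archFactor_twinPrimeSystem, pow_one]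
    rw [show (∑ m ∈ Finset.Icc 1 n, Λ m * Λ (m + 2)) = X 2 n from rfl]
    field_simp
  rw [Finset.sum_congr rfl hterm] at key
  exact key

/-- Door 18 (route-Parity-ScaleTauberianCarving), TYPED: the residual `LogWindowHL` alone refutes `TwinPoor` — log-window
Hardy–Littlewood at the twin pattern is incompatible with twin poverty (`not_poor_of_logExact`); so is the leaf it
re-splits (`fixedLower_refutes_twinPoor`), while its partner `ScaleRigidity` is `W`-vacuous at poor patterns modulo main-term
homogeneity (`scaleRigidityAt_of_poorAt`). -/
theorem logWindowHL_refutes_twinPoor (h : Theses.ScaleTauberianCarving.LogWindowHL) : ¬ TwinPoor :=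
  not_poor_of_logExact (ne_of_gt twin_singularProduct_pos) (logExact_twin_of_logWindowHL h)

/-- `LogWindowHL ⟹ twinSet.Infinite` (door 18's residual carries the twin existence content, in tree currency). -/
theorem twinSet_infinite_of_logWindowHL (h : Theses.ScaleTauberianCarving.LogWindowHL) : twinSet.Infinite :=
  twinSet_infinite_of_not_twinPoor (logWindowHL_refutes_twinPoor h)

/-! ### §5.8 Door 5 typed: the residual `PairsToGHL` (stmt-Parity-9389) is `W`-vacuous -/

/-- The antecedent of `PairsToGHL` (the pair Hardy–Littlewood asymptotic at every shift `h ≥ 1`, `o(N)` form) contains the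
twin asymptotic, which refutes `TwinPoor`; hence `PairsToGHL` HOLDS in the twin poverty world (shape
`conditioned_on_refuting_vacuous`).  By `root_conservation`, in door 5 (route-Parity-BarrierZoneCarving:
`GHL ⟸ K ∧ F ∧ W ∧ P ∧ Spine ∧ PairsToGHL`) the ATTACKED mechanism line carries `¬TwinPoor` (`barrierZone_locus`). -/
theorem pairsToGHL_of_twinPoor (hW : TwinPoor) : Theses.BarrierZoneCarving.PairsToGHL := by
  intro hpairs
  exfalso
  have h2 := hpairs 2 (by norm_num)
  have hE : Exact (X 2) (Spair 2) := by
    intro ε hε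
    obtain ⟨N₀, hN₀⟩ := Filter.eventually_atTop.mp (h2.def hε)
    refine ⟨N₀, fun N hN => ?_⟩
    have key := hN₀ N hN
    rw [Real.norm_eq_abs, Real.norm_eq_abs, Nat.abs_cast] at key
    exact key
  exact not_poor_of_exact (ne_of_gt (lt_of_lt_of_le one_pos (one_le_Spair even_two two_ne_zero))) hE hW

/-- Door 5 locus: whatever `A` closes `GeneralizedHardyLittlewood` together with `PairsToGHL` refutes `TwinPoor` on its own. -/
theorem barrierZone_locus {A : Prop}
    (hs : A → Theses.BarrierZoneCarving.PairsToGHL → _root_.GeneralizedHardyLittlewood) : A → ¬ TwinPoor :=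
  fun a w => ghl_refutes_twinPoor (hs a (pairsToGHL_of_twinPoor w)) w

/-! ### §5.9 Doors 13 / 15 / 16 typed (critic P1, HOME/STATUS.md l.472): residual lift ∧ credited piece ⟹ ¬TwinPoor -/

/-- In `W` a lift-shaped residual `X → FixedLower` holds iff its credited antecedent fails: a lift residual ALONE is not
`W`-refuting; the burden sits in the residual RELATIVE TO the credited piece (critic's dichotomy, P1). -/
theorem lift_residual_inside_twinPoor {Xp : Prop} (hW : TwinPoor) :
    (Xp → Theses.SiegelSpectrumSplit.FixedLower) ↔ ¬ Xp :=
  ⟨fun h x => fixedLower_refutes_twinPoor (h x) hW, fun hn x => absurd x hn⟩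

/-- Door 13 (route-Parity-GhostBoundaryCarving): `TwoOfThree ∧ PairLift ⟹ ¬TwinPoor`, by the landed
`GhostBoundaryCarving.fixedLower_iff_pieces`. -/
theorem pairLift_and_twoOfThree_refute_twinPoor (hT : Theses.GhostBoundaryCarving.TwoOfThree)
    (hP : Theses.GhostBoundaryCarving.PairLift) : ¬ TwinPoor :=
  fixedLower_refutes_twinPoor (Theses.GhostBoundaryCarving.fixedLower_iff_pieces.mpr ⟨hT, hP⟩)

/-- Door 15 (route-Parity-ArtinGenericSplit): `ArtinTwo ∧ ArtinLift ⟹ ¬TwinPoor`, by the landed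
`ArtinGenericSplitNecessity.fixedLower_of_pieces`. -/
theorem artinLift_and_artinTwo_refute_twinPoor (hA : Theses.ArtinGenericSplit.ArtinTwo)
    (hR : Theses.ArtinGenericSplit.ArtinLift) : ¬ TwinPoor :=
  fixedLower_refutes_twinPoor (ArtinGenericSplitNecessity.fixedLower_of_pieces hA hR)

/-- Door 16 (route-Parity-ShiftedPrimeFactor): `ShiftedLPF ∧ FactorLift ⟹ ¬TwinPoor`, by the landed
`ShiftedPrimeFactor.fixedLower_of_pieces`. -/
theorem factorLift_and_shiftedLPF_refute_twinPoor (hS : Theses.ShiftedPrimeFactor.ShiftedLPF)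
    (hF : Theses.ShiftedPrimeFactor.FactorLift) : ¬ TwinPoor :=
  fixedLower_refutes_twinPoor (Theses.ShiftedPrimeFactor.fixedLower_of_pieces hS hF)

end Root

end Summit.Parity.GeneralizedHardyLittlewood.ExistenceConservation
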